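import Summits.AtomisticToContinuum.FouriersLaw.Theses.BondHeatUncertainty
import Summits.AtomisticToContinuum.FouriersLaw.Theorems.BondHeatUncertaintySubdiffusiveBondHeatBathBondReductionFlowLaws

/-!
# `SubdiffusiveBondHeat` / bath-bond reduction, part 5: end-point correlations and lag correlations

Helper file for crux `stmt-AtomisticToContinuum-9120` (`BondHeatUncertainty.SubdiffusiveBondHeat`), line
`bath-bond-deficit-integral`, stub `stub_bathBondReduction`. Continuing the dictionary between kernel-level
pairings `∫ f · (P_r h) dμ` and correlations of the constructed flow `z_s = Φ_s(x,B)` under an initial law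
`μ` INVARIANT for the constructed kernels (hypothesis; clause (a) of `BoundaryEscapeDeficit.BoundaryKernelBasics`
for the Gibbs measure), for `f, h, k ∈ L²(μ)` and `t ≥ 0`:

* `pinnedChain_integrable_uncurry_pointTime_of_invariant`, `pinnedChain_integrable_mul_intervalIntegral_of_invariant`
  — integrability of `k(z_r) ∫₀ᵗ f(z_s) ds`;
* `pinnedChain_integral_mul_intervalIntegral_final_of_invariant` —
  `E[k(z_t) ∫₀ᵗ f(z_s) ds] = ∫₀ᵗ ∫ f · (P_{t-s} k) dμ ds` (registered sub-goal `pinnedChain_endPointCorrelation`);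
* `pinnedChain_integral_mul_intervalIntegral_initial_of_invariant` —
  `E[k(z_0) ∫₀ᵗ f(z_s) ds] = ∫₀ᵗ ∫ k · (P_s f) dμ ds`;
* `pinnedChain_measurable_pathCorr`, `pinnedChain_abs_pathCorr_le`, `pinnedChain_pathCorr_eq_of_nonneg` — the lag
  correlation `r ↦ E[f(z_0) h(z_r)]` is measurable, bounded by `∫f² + ∫h²`, and equals `∫ f · (P_r h) dμ` for
  `r ≥ 0`;
* `pinnedChain_integral_integral_kernelPairing_triangle` — `∫₀ᵗ∫₀ˢ ∫ f·(P_u h) dμ du ds = ∫₀ᵗ (t-r) ∫ f·(P_r h) dμ dr`.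

These are the `E[Δe₀ · ∫ j₀]`, `E[Δe₀ · ∫ g]` terms of the bath-heat variance identity. Nothing here closes an item.
-/

noncomputable section

open MeasureTheory ProbabilityTheory Filter Topology Set intervalIntegral
open scoped NNReal ENNReal
open Literature.MathematicalPhysics.KineticTheory.HeatConduction Literature.Probability.Process

namespace Summit.AtomisticToContinuum.FouriersLaw.Theorems.SubdiffusiveBondHeat

open OscillatorChain

/-! ### Correlations of a time integral with a one-time value along the stationary flow -/

section EndPoint

variable {ω₂ lam β γ : ℝ} (hω : 0 < ω₂) (hl : 0 ≤ lam) (hβ : 0 ≤ β) (hγ : 0 ≤ γ) (N : ℕ) (T_L T_R : ℝ)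
include hω hl hβ hγ

/-- Integrability on `Ω × (0,t]` of `(p, s) ↦ k(z_r(p)) f(z_s(p))` for `f, k ∈ L²(μ)` under an invariant initial
law, for every fixed real time `r`. [folklore] -/
theorem pinnedChain_integrable_uncurry_pointTime_of_invariant (μ : Measure (PhaseSpace N)) [SFinite μ]
    (hinv : ∀ s : ℝ≥0, μ.bind ((pinnedChain ω₂ lam β γ).transitionKernel N T_L T_R s) = μ)
    {f k : PhaseSpace N → ℝ} (hf : Measurable f) (hk : Measurable k)
    (hf2 : Integrable (fun y => f y ^ 2) μ) (hk2 : Integrable (fun y => k y ^ 2) μ) (r t : ℝ) :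
    Integrable (Function.uncurry fun (p : PhaseSpace N × WienerPair) (s : ℝ) =>
      k ((pinnedChain ω₂ lam β γ).solMap N T_L T_R r p.1 (pairPath p.2)) *
        f ((pinnedChain ω₂ lam β γ).solMap N T_L T_R s p.1 (pairPath p.2)))
      ((μ.prod wienerPair).prod ((volume : Measure ℝ).restrict (Ioc 0 t))) := by
  haveI hLfin : IsFiniteMeasure ((volume : Measure ℝ).restrict (Ioc 0 t)) := by
    refine ⟨?_⟩
    rw [Measure.restrict_apply_univ]
    exact measure_Ioc_lt_top
  have hZ := pinnedChain_measurable_solMap_process hω hl hβ hγ N T_L T_R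
  set G : (PhaseSpace N × WienerPair) × ℝ → ℝ := fun w =>
    k ((pinnedChain ω₂ lam β γ).solMap N T_L T_R r w.1.1 (pairPath w.1.2)) *
      f ((pinnedChain ω₂ lam β γ).solMap N T_L T_R w.2 w.1.1 (pairPath w.1.2)) with hG
  have h1M : Measurable fun w : (PhaseSpace N × WienerPair) × ℝ =>
      k ((pinnedChain ω₂ lam β γ).solMap N T_L T_R r w.1.1 (pairPath w.1.2)) := by
    have h1 : Measurable fun w : (PhaseSpace N × WienerPair) × ℝ => (r, w.1) := measurable_const.prodMk measurable_fst
    have hA := hk.comp (hZ.comp h1)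
    exact hA
  have h2M : Measurable fun w : (PhaseSpace N × WienerPair) × ℝ =>
      f ((pinnedChain ω₂ lam β γ).solMap N T_L T_R w.2 w.1.1 (pairPath w.1.2)) := by
    have h2 : Measurable fun w : (PhaseSpace N × WienerPair) × ℝ => (w.2, w.1) := measurable_snd.prodMk measurable_fst
    have hB := hf.comp (hZ.comp h2)
    exact hB
  have hGm : Measurable G := by
    have hAB := h1M.mul h2M
    exact hAB
  have hCf : ∫⁻ y, ‖f y‖ₑ ^ 2 ∂μ < ∞ := by
    have h1 := hf2.hasFiniteIntegral
    unfold HasFiniteIntegral at h1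
    simpa [enorm_pow] using h1
  have hCk : ∫⁻ y, ‖k y‖ₑ ^ 2 ∂μ < ∞ := by
    have h1 := hk2.hasFiniteIntegral
    unfold HasFiniteIntegral at h1
    simpa [enorm_pow] using h1
  have hGi : Integrable G ((μ.prod wienerPair).prod ((volume : Measure ℝ).restrict (Ioc 0 t))) := by
    refine ⟨hGm.aestronglyMeasurable, ?_⟩
    unfold HasFiniteIntegral
    have h1m : Measurable fun w : (PhaseSpace N × WienerPair) × ℝ =>
        ‖k ((pinnedChain ω₂ lam β γ).solMap N T_L T_R r w.1.1 (pairPath w.1.2))‖ₑ ^ 2 := by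
      have hA := h1M.enorm.pow_const 2
      exact hA
    have h2m : Measurable fun w : (PhaseSpace N × WienerPair) × ℝ =>
        ‖f ((pinnedChain ω₂ lam β γ).solMap N T_L T_R w.2 w.1.1 (pairPath w.1.2))‖ₑ ^ 2 := by
      have hB := h2M.enorm.pow_const 2
      exact hB
    calc ∫⁻ w, ‖G w‖ₑ ∂((μ.prod wienerPair).prod ((volume : Measure ℝ).restrict (Ioc 0 t)))
        ≤ ∫⁻ w, (‖k ((pinnedChain ω₂ lam β γ).solMap N T_L T_R r w.1.1 (pairPath w.1.2))‖ₑ ^ 2 +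
            ‖f ((pinnedChain ω₂ lam β γ).solMap N T_L T_R w.2 w.1.1 (pairPath w.1.2))‖ₑ ^ 2)
            ∂((μ.prod wienerPair).prod ((volume : Measure ℝ).restrict (Ioc 0 t))) := by
          refine lintegral_mono fun w => ?_
          simp only [hG, enorm_mul]
          exact ennreal_mul_le_sq_add_sq _ _
      _ = (∫⁻ y, ‖k y‖ₑ ^ 2 ∂μ) * ((volume : Measure ℝ).restrict (Ioc 0 t)) univ +
            (∫⁻ y, ‖f y‖ₑ ^ 2 ∂μ) * ((volume : Measure ℝ).restrict (Ioc 0 t)) univ := by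
          rw [lintegral_add_left h1m, lintegral_prod_symm _ h1m.aemeasurable, lintegral_prod_symm _ h2m.aemeasurable]
          congr 1
          · rw [← lintegral_const]
            refine lintegral_congr fun s => ?_
            exact pinnedChain_lintegral_sq_solMap_of_invariant hω hl hβ hγ N T_L T_R μ hinv hk r
          · rw [← lintegral_const]
            refine lintegral_congr fun s => ?_
            exact pinnedChain_lintegral_sq_solMap_of_invariant hω hl hβ hγ N T_L T_R μ hinv hf s
      _ < ∞ := ENNReal.add_lt_top.2 ⟨ENNReal.mul_lt_top hCk (measure_lt_top _ _),
            ENNReal.mul_lt_top hCf (measure_lt_top _ _)⟩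
  exact hGi

/-- Integrability of `k(z_r) ∫₀ᵗ f(z_s) ds` along the stationary flow (`f, k ∈ L²(μ)`, `t ≥ 0`). [folklore] -/
theorem pinnedChain_integrable_mul_intervalIntegral_of_invariant (μ : Measure (PhaseSpace N)) [SFinite μ]
    (hinv : ∀ s : ℝ≥0, μ.bind ((pinnedChain ω₂ lam β γ).transitionKernel N T_L T_R s) = μ)
    {f k : PhaseSpace N → ℝ} (hf : Measurable f) (hk : Measurable k)
    (hf2 : Integrable (fun y => f y ^ 2) μ) (hk2 : Integrable (fun y => k y ^ 2) μ) (r : ℝ) {t : ℝ} (ht : 0 ≤ t) :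
    Integrable (fun p : PhaseSpace N × WienerPair =>
      k ((pinnedChain ω₂ lam β γ).solMap N T_L T_R r p.1 (pairPath p.2)) *
        (∫ s in (0 : ℝ)..t, f ((pinnedChain ω₂ lam β γ).solMap N T_L T_R s p.1 (pairPath p.2)))) (μ.prod wienerPair) := by
  have hGi := pinnedChain_integrable_uncurry_pointTime_of_invariant hω hl hβ hγ N T_L T_R μ hinv hf hk hf2 hk2 r t
  refine hGi.integral_prod_left.congr (Eventually.of_forall fun p => ?_)
  simp only [Function.uncurry]
  rw [integral_of_le ht, ← MeasureTheory.integral_const_mul]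

/-- **Correlation of a time integral with a one-time value**: under an invariant initial law, for a real
time `r ∈ [0, t]`... more precisely for `0 ≤ r` with `r ≤ t` or `t ≤ r` handled by the lag `|r - s|`:
here the FINAL-value case `r = t`: `E_{μ⊗W}[k(z_t) ∫₀ᵗ f(z_s) ds] = ∫₀ᵗ ∫ f · (P_{t-s} k) dμ ds` for
`f, k ∈ L²(μ)`, `t ≥ 0`. [folklore] -/
theorem pinnedChain_integral_mul_intervalIntegral_final_of_invariant (μ : Measure (PhaseSpace N)) [SFinite μ]
    (hinv : ∀ s : ℝ≥0, μ.bind ((pinnedChain ω₂ lam β γ).transitionKernel N T_L T_R s) = μ)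
    {f k : PhaseSpace N → ℝ} (hf : Measurable f) (hk : Measurable k)
    (hf2 : Integrable (fun y => f y ^ 2) μ) (hk2 : Integrable (fun y => k y ^ 2) μ) {t : ℝ} (ht : 0 ≤ t) :
    ∫ p, k ((pinnedChain ω₂ lam β γ).solMap N T_L T_R t p.1 (pairPath p.2)) *
        (∫ s in (0 : ℝ)..t, f ((pinnedChain ω₂ lam β γ).solMap N T_L T_R s p.1 (pairPath p.2))) ∂(μ.prod wienerPair) =
      ∫ s in (0 : ℝ)..t,
        ∫ y, f y * (∫ y', k y' ∂((pinnedChain ω₂ lam β γ).transitionKernel N T_L T_R (t - s).toNNReal y)) ∂μ := by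
  have hGi' := pinnedChain_integrable_uncurry_pointTime_of_invariant hω hl hβ hγ N T_L T_R μ hinv hf hk hf2 hk2 t t
  have hpt : ∀ p : PhaseSpace N × WienerPair,
      k ((pinnedChain ω₂ lam β γ).solMap N T_L T_R t p.1 (pairPath p.2)) *
        (∫ s in (0 : ℝ)..t, f ((pinnedChain ω₂ lam β γ).solMap N T_L T_R s p.1 (pairPath p.2))) =
      ∫ s in Ioc 0 t, k ((pinnedChain ω₂ lam β γ).solMap N T_L T_R t p.1 (pairPath p.2)) *
        f ((pinnedChain ω₂ lam β γ).solMap N T_L T_R s p.1 (pairPath p.2)) := by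
    intro p
    rw [integral_of_le ht, ← MeasureTheory.integral_const_mul]
  rw [integral_congr_ae (Eventually.of_forall hpt), integral_integral_swap hGi', ← integral_of_le ht]
  refine intervalIntegral.integral_congr fun s hs => ?_
  rw [uIcc_of_le ht] at hs
  have heq : ∫ p, k ((pinnedChain ω₂ lam β γ).solMap N T_L T_R t p.1 (pairPath p.2)) *
      f ((pinnedChain ω₂ lam β γ).solMap N T_L T_R s p.1 (pairPath p.2)) ∂(μ.prod wienerPair) =
      ∫ p, f ((pinnedChain ω₂ lam β γ).solMap N T_L T_R s p.1 (pairPath p.2)) *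
        k ((pinnedChain ω₂ lam β γ).solMap N T_L T_R t p.1 (pairPath p.2)) ∂(μ.prod wienerPair) :=
    integral_congr_ae (Eventually.of_forall fun p => mul_comm _ _)
  rw [heq]
  exact pinnedChain_integral_mul_solMap_of_invariant hω hl hβ hγ N T_L T_R μ hinv hf hk hf2 hk2 hs.1 hs.2

/-- **Correlation of a time integral with the initial value**: under an invariant initial law,
`E_{μ⊗W}[k(z_0) ∫₀ᵗ f(z_s) ds] = ∫₀ᵗ ∫ k · (P_s f) dμ ds` for `f, k ∈ L²(μ)`, `t ≥ 0`. [folklore] -/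
theorem pinnedChain_integral_mul_intervalIntegral_initial_of_invariant (μ : Measure (PhaseSpace N)) [SFinite μ]
    (hinv : ∀ s : ℝ≥0, μ.bind ((pinnedChain ω₂ lam β γ).transitionKernel N T_L T_R s) = μ)
    {f k : PhaseSpace N → ℝ} (hf : Measurable f) (hk : Measurable k)
    (hf2 : Integrable (fun y => f y ^ 2) μ) (hk2 : Integrable (fun y => k y ^ 2) μ) {t : ℝ} (ht : 0 ≤ t) :
    ∫ p, k ((pinnedChain ω₂ lam β γ).solMap N T_L T_R 0 p.1 (pairPath p.2)) *
        (∫ s in (0 : ℝ)..t, f ((pinnedChain ω₂ lam β γ).solMap N T_L T_R s p.1 (pairPath p.2))) ∂(μ.prod wienerPair) =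
      ∫ s in (0 : ℝ)..t,
        ∫ y, k y * (∫ y', f y' ∂((pinnedChain ω₂ lam β γ).transitionKernel N T_L T_R s.toNNReal y)) ∂μ := by
  have hGi' := pinnedChain_integrable_uncurry_pointTime_of_invariant hω hl hβ hγ N T_L T_R μ hinv hf hk hf2 hk2 0 t
  have hpt : ∀ p : PhaseSpace N × WienerPair,
      k ((pinnedChain ω₂ lam β γ).solMap N T_L T_R 0 p.1 (pairPath p.2)) *
        (∫ s in (0 : ℝ)..t, f ((pinnedChain ω₂ lam β γ).solMap N T_L T_R s p.1 (pairPath p.2))) =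
      ∫ s in Ioc 0 t, k ((pinnedChain ω₂ lam β γ).solMap N T_L T_R 0 p.1 (pairPath p.2)) *
        f ((pinnedChain ω₂ lam β γ).solMap N T_L T_R s p.1 (pairPath p.2)) := by
    intro p
    rw [integral_of_le ht, ← MeasureTheory.integral_const_mul]
  rw [integral_congr_ae (Eventually.of_forall hpt), integral_integral_swap hGi', ← integral_of_le ht]
  refine intervalIntegral.integral_congr fun s hs => ?_
  rw [uIcc_of_le ht] at hs
  have h1 := pinnedChain_integral_mul_solMap_of_invariant hω hl hβ hγ N T_L T_R μ hinv hk hf hk2 hf2 le_rfl hs.1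
  rw [sub_zero] at h1
  exact h1

end EndPoint

/-! ### The path-space lag correlation: measurability, bound, kernel form -/

section PathCorr

variable {ω₂ lam β γ : ℝ} (hω : 0 < ω₂) (hl : 0 ≤ lam) (hβ : 0 ≤ β) (hγ : 0 ≤ γ) (N : ℕ) (T_L T_R : ℝ)
include hω hl hβ hγ

/-- The lag correlation `r ↦ E_{μ⊗W}[f(z_0) h(z_r)]` is measurable on `ℝ` (`f, h` measurable). [folklore] -/
theorem pinnedChain_measurable_pathCorr (μ : Measure (PhaseSpace N)) [SFinite μ]
    {f h : PhaseSpace N → ℝ} (hf : Measurable f) (hh : Measurable h) :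
    Measurable fun r : ℝ => ∫ p, f ((pinnedChain ω₂ lam β γ).solMap N T_L T_R 0 p.1 (pairPath p.2)) *
      h ((pinnedChain ω₂ lam β γ).solMap N T_L T_R r p.1 (pairPath p.2)) ∂(μ.prod wienerPair) := by
  have hZ := pinnedChain_measurable_solMap_process hω hl hβ hγ N T_L T_R
  have hsm : StronglyMeasurable (Function.uncurry fun (r : ℝ) (p : PhaseSpace N × WienerPair) =>
      f ((pinnedChain ω₂ lam β γ).solMap N T_L T_R 0 p.1 (pairPath p.2)) *
        h ((pinnedChain ω₂ lam β γ).solMap N T_L T_R r p.1 (pairPath p.2))) := by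
    refine Measurable.stronglyMeasurable ?_
    have h0 : Measurable fun q : ℝ × (PhaseSpace N × WienerPair) => ((0 : ℝ), q.2) :=
      measurable_const.prodMk measurable_snd
    have hA := (hf.comp (hZ.comp h0)).mul (hh.comp hZ)
    exact hA
  exact (hsm.integral_prod_right (ν := μ.prod wienerPair)).measurable

/-- The lag correlation is bounded by `∫ f² dμ + ∫ h² dμ` under an invariant initial law. [folklore] -/
theorem pinnedChain_abs_pathCorr_le (μ : Measure (PhaseSpace N)) [SFinite μ]
    (hinv : ∀ s : ℝ≥0, μ.bind ((pinnedChain ω₂ lam β γ).transitionKernel N T_L T_R s) = μ)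
    {f h : PhaseSpace N → ℝ} (hf : Measurable f) (hh : Measurable h)
    (hf2 : Integrable (fun y => f y ^ 2) μ) (hh2 : Integrable (fun y => h y ^ 2) μ) (s r : ℝ) :
    |∫ p, f ((pinnedChain ω₂ lam β γ).solMap N T_L T_R s p.1 (pairPath p.2)) *
        h ((pinnedChain ω₂ lam β γ).solMap N T_L T_R r p.1 (pairPath p.2)) ∂(μ.prod wienerPair)| ≤
      (∫ y, f y ^ 2 ∂μ) + ∫ y, h y ^ 2 ∂μ := by
  have hF2 := pinnedChain_integrable_sq_solMap_of_invariant hω hl hβ hγ N T_L T_R μ hinv hf2 s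
  have hH2 := pinnedChain_integrable_sq_solMap_of_invariant hω hl hβ hγ N T_L T_R μ hinv hh2 r
  have hm : Measurable (fun p : PhaseSpace N × WienerPair =>
      f ((pinnedChain ω₂ lam β γ).solMap N T_L T_R s p.1 (pairPath p.2)) *
        h ((pinnedChain ω₂ lam β γ).solMap N T_L T_R r p.1 (pairPath p.2))) :=
    (hf.comp (pinnedChain_measurable_solMap_pairPath hω hl hβ hγ N T_L T_R s)).mul
      (hh.comp (pinnedChain_measurable_solMap_pairPath hω hl hβ hγ N T_L T_R r))
  have hint : Integrable (fun p : PhaseSpace N × WienerPair =>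
      f ((pinnedChain ω₂ lam β γ).solMap N T_L T_R s p.1 (pairPath p.2)) *
        h ((pinnedChain ω₂ lam β γ).solMap N T_L T_R r p.1 (pairPath p.2))) (μ.prod wienerPair) := by
    refine (hF2.1.add hH2.1).mono' hm.aestronglyMeasurable (Eventually.of_forall fun p => ?_)
    simpa [Real.norm_eq_abs] using abs_mul_le_sq_add_sq _ _
  rw [← hF2.2, ← hH2.2, ← integral_add hF2.1 hH2.1, ← Real.norm_eq_abs]
  refine (MeasureTheory.norm_integral_le_integral_norm _).trans
    (integral_mono hint.norm (hF2.1.add hH2.1) fun p => ?_)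
  simpa [Real.norm_eq_abs] using abs_mul_le_sq_add_sq _ _

/-- For `r ≥ 0` the lag correlation is the kernel pairing `∫ f · (P_r h) dμ`. [folklore] -/
theorem pinnedChain_pathCorr_eq_of_nonneg (μ : Measure (PhaseSpace N)) [SFinite μ]
    (hinv : ∀ s : ℝ≥0, μ.bind ((pinnedChain ω₂ lam β γ).transitionKernel N T_L T_R s) = μ)
    {f h : PhaseSpace N → ℝ} (hf : Measurable f) (hh : Measurable h)
    (hf2 : Integrable (fun y => f y ^ 2) μ) (hh2 : Integrable (fun y => h y ^ 2) μ) {r : ℝ} (hr : 0 ≤ r) :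
    ∫ p, f ((pinnedChain ω₂ lam β γ).solMap N T_L T_R 0 p.1 (pairPath p.2)) *
        h ((pinnedChain ω₂ lam β γ).solMap N T_L T_R r p.1 (pairPath p.2)) ∂(μ.prod wienerPair) =
      ∫ y, f y * (∫ y', h y' ∂((pinnedChain ω₂ lam β γ).transitionKernel N T_L T_R r.toNNReal y)) ∂μ := by
  have h1 := pinnedChain_integral_mul_solMap_of_invariant hω hl hβ hγ N T_L T_R μ hinv hf hh hf2 hh2 le_rfl hr
  rw [sub_zero] at h1
  exact h1

/-- **The triangle identity for kernel pairings**: `∫₀ᵗ ∫₀ˢ ∫ f·(P_u h) dμ du ds = ∫₀ᵗ (t-r) ∫ f·(P_r h) dμ dr`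
(`f, h ∈ L²(μ)`, invariant `μ`, `t ≥ 0`). [folklore] -/
theorem pinnedChain_integral_integral_kernelPairing_triangle (μ : Measure (PhaseSpace N)) [SFinite μ]
    (hinv : ∀ s : ℝ≥0, μ.bind ((pinnedChain ω₂ lam β γ).transitionKernel N T_L T_R s) = μ)
    {f h : PhaseSpace N → ℝ} (hf : Measurable f) (hh : Measurable h)
    (hf2 : Integrable (fun y => f y ^ 2) μ) (hh2 : Integrable (fun y => h y ^ 2) μ) {t : ℝ} (ht : 0 ≤ t) :
    ∫ s in (0 : ℝ)..t, (∫ u in (0 : ℝ)..s,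
        ∫ y, f y * (∫ y', h y' ∂((pinnedChain ω₂ lam β γ).transitionKernel N T_L T_R u.toNNReal y)) ∂μ) =
      ∫ r in (0 : ℝ)..t, (t - r) *
        ∫ y, f y * (∫ y', h y' ∂((pinnedChain ω₂ lam β γ).transitionKernel N T_L T_R r.toNNReal y)) ∂μ := by
  have ham := pinnedChain_measurable_pathCorr hω hl hβ hγ N T_L T_R μ hf hh
  have haB : ∀ r, |∫ p, f ((pinnedChain ω₂ lam β γ).solMap N T_L T_R 0 p.1 (pairPath p.2)) *
      h ((pinnedChain ω₂ lam β γ).solMap N T_L T_R r p.1 (pairPath p.2)) ∂(μ.prod wienerPair)| ≤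
      (∫ y, f y ^ 2 ∂μ) + ∫ y, h y ^ 2 ∂μ :=
    fun r => pinnedChain_abs_pathCorr_le hω hl hβ hγ N T_L T_R μ hinv hf hh hf2 hh2 0 r
  have key := integral_integral_triangle_eq ham haB ht
  have hconv : ∀ r ∈ uIcc (0 : ℝ) t,
      ∫ p, f ((pinnedChain ω₂ lam β γ).solMap N T_L T_R 0 p.1 (pairPath p.2)) *
        h ((pinnedChain ω₂ lam β γ).solMap N T_L T_R r p.1 (pairPath p.2)) ∂(μ.prod wienerPair) =
      ∫ y, f y * (∫ y', h y' ∂((pinnedChain ω₂ lam β γ).transitionKernel N T_L T_R r.toNNReal y)) ∂μ := by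
    intro r hr
    rw [uIcc_of_le ht] at hr
    exact pinnedChain_pathCorr_eq_of_nonneg hω hl hβ hγ N T_L T_R μ hinv hf hh hf2 hh2 hr.1
  have hL : ∫ s in (0 : ℝ)..t, (∫ u in (0 : ℝ)..s,
        ∫ y, f y * (∫ y', h y' ∂((pinnedChain ω₂ lam β γ).transitionKernel N T_L T_R u.toNNReal y)) ∂μ) =
      ∫ s in (0 : ℝ)..t, (∫ u in (0 : ℝ)..s,
        ∫ p, f ((pinnedChain ω₂ lam β γ).solMap N T_L T_R 0 p.1 (pairPath p.2)) *
          h ((pinnedChain ω₂ lam β γ).solMap N T_L T_R u p.1 (pairPath p.2)) ∂(μ.prod wienerPair)) := by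
    refine intervalIntegral.integral_congr fun s hs => ?_
    rw [uIcc_of_le ht] at hs
    refine intervalIntegral.integral_congr fun u hu => ?_
    rw [uIcc_of_le hs.1] at hu
    exact (hconv u (by rw [uIcc_of_le ht]; exact ⟨hu.1, hu.2.trans hs.2⟩)).symm
  have hR : ∫ r in (0 : ℝ)..t, (t - r) *
        ∫ y, f y * (∫ y', h y' ∂((pinnedChain ω₂ lam β γ).transitionKernel N T_L T_R r.toNNReal y)) ∂μ =
      ∫ r in (0 : ℝ)..t, (t - r) *
        ∫ p, f ((pinnedChain ω₂ lam β γ).solMap N T_L T_R 0 p.1 (pairPath p.2)) *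
          h ((pinnedChain ω₂ lam β γ).solMap N T_L T_R r p.1 (pairPath p.2)) ∂(μ.prod wienerPair) := by
    refine intervalIntegral.integral_congr fun r hr => ?_
    rw [hconv r hr]
  rw [hL, hR, key]

end PathCorr

/-- **End-point correlation of a time integral along the stationary constructed flow** (registered sub-goal of
`stub_bathBondReduction`; closed form of `pinnedChain_integral_mul_intervalIntegral_final_of_invariant`): for the
pinned chain (`ω₂ > 0`, `lam, β, γ ≥ 0`), an s-finite initial law `μ` invariant for the constructed kernels,
`f, k` measurable with `f², k² ∈ L¹(μ)` and `t ≥ 0`: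
`E_{μ⊗W}[k(z_t) ∫₀ᵗ f(z_s) ds] = ∫₀ᵗ ∫ f · (P_{t-s} k) dμ ds`. [folklore] -/
theorem pinnedChain_endPointCorrelation :
    ∀ (ω₂ lam β γ : ℝ), 0 < ω₂ → 0 ≤ lam → 0 ≤ β → 0 ≤ γ → ∀ (N : ℕ) (T_L T_R : ℝ)
      (μ : MeasureTheory.Measure (PhaseSpace N)) [MeasureTheory.SFinite μ],
      (∀ s : NNReal, μ.bind ((pinnedChain ω₂ lam β γ).transitionKernel N T_L T_R s) = μ) →
      ∀ (f k : PhaseSpace N → ℝ), Measurable f → Measurable k →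
      MeasureTheory.Integrable (fun y => f y ^ 2) μ → MeasureTheory.Integrable (fun y => k y ^ 2) μ →
      ∀ t : ℝ, 0 ≤ t →
        ∫ p, k ((pinnedChain ω₂ lam β γ).solMap N T_L T_R t p.1 (Literature.Probability.Process.pairPath p.2)) *
            (∫ s in (0 : ℝ)..t, f ((pinnedChain ω₂ lam β γ).solMap N T_L T_R s p.1
              (Literature.Probability.Process.pairPath p.2))) ∂(μ.prod Literature.Probability.Process.wienerPair) =
          ∫ s in (0 : ℝ)..t, ∫ y, f y *
            (∫ y', k y' ∂((pinnedChain ω₂ lam β γ).transitionKernel N T_L T_R (t - s).toNNReal y)) ∂μ := by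
  intro ω₂ lam β γ hω hl hβ hγ N T_L T_R μ _ hinv f k hf hk hf2 hk2 t ht
  exact pinnedChain_integral_mul_intervalIntegral_final_of_invariant hω hl hβ hγ N T_L T_R μ hinv hf hk hf2 hk2 ht

end Summit.AtomisticToContinuum.FouriersLaw.Theorems.SubdiffusiveBondHeat
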